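import Summits.Ventures.LatticeQCDFlow.TrivializingMaps.FlowAutocorrelationFloorAnyGroup

/-!
HONEST FRAMING: exact (Metropolis-corrected) sampling algorithms for lattice gauge theory; figures
of merit are autocorrelation/cost numbers at stated couplings and volumes; no continuum-physics
claim.

# FlowTauIntWindowFloor — THE AUTOCORRELATION FLOOR IN THE CELL'S FITNESS VOCABULARY: the windowed
# integrated autocorrelation time of every bounded observable of the exact flow sampler of the Wilson measure
# obeys `τ_W ≥ ½ + W·θ^W`, `θ = max 0 (1 − B²·acc/E_β[g²])` — every compact gauge group, every coupling
# (lean-2 GEN-12, ours)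

Venture-side (OURS).  Cell `lqcd-flow` (pub-lqcd), unit `pub-lqcd-lean-2-g12`, 2026-08-23.  The all-lag floor
`ρ_g(n+1) ≥ θ^{n+1}` of `FlowAutocorrelationFloorAnyGroup` summed over the Γ-method window: with the cell's
`Scoring.tauIntWindow ρ W = ½ + Σ_{t=1}^{W} ρ(t)` (`Scoring/CalibrationTruths`),

* `tauIntWindow_ge_of_pow_le` — `θ ∈ [0,1]`, `ρ(t+1) ≥ θ^{t+1}` for `t < W` ⇒ `τ_W(ρ) ≥ ½ + W·θ^W`;
* **`wilson_flow_tauIntWindow_ge`** — for the exact flow sampler of `μ_β` with model density `0 < q`, `∫ q = 1`,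
  every bounded measurable `g` (`|g| ≤ B`, `E_β[g²] > 0`) and every window `W`:
  `τ_W(ρ_g) ≥ ½ + W·(max 0 (1 − B²·acc/E_β[g²]))^W`;
* **`wilson_flow_tauIntWindow_ge_allCouplings`** (unitary `ρ`, `d ≥ 2`, `L ≥ 2`, `β ≥ 0`, `q ≤ C`) — the same with
  `acc` replaced by GEN-11's ceiling `C·exp(−e^{−β·2NK(1+4K)}⌊L/2⌋^d·Var_Haar(Re tr ρ)·β²/4)`.

Reading (no numerics implied): as long as the window `W` is below `1/ε` (`ε = B²·acc/E_β[g²]`, exponentially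
small in the volume for a `C`-bounded model), `θ^W ≥ (1 − ε)^{1/ε} ≥ 1/4` (`ε ≤ ½`), so the Γ-method's `τ_W`
of every such observable is at least `W/4`: the measured integrated autocorrelation time grows linearly with
the window up to exponentially large windows.  NOT CLAIMED: `τ_int` itself (summability); any number for a
trained network.  Literature grade: KNOWN MECHANISM, NEW TYPING; nothing is cited as a fact.
-/

noncomputable section

open MeasureTheory ProbabilityTheory Real Set Filter Finset
open Literature.MathematicalPhysics.QuantumFieldTheory
open Literature.MathematicalPhysics.QuantumFieldTheory.Luscher2010
open Summit.Ventures.LatticeQCDFlow.Exactness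
open Summit.Ventures.LatticeQCDFlow.Scaling
open Summit.Ventures.LatticeQCDFlow.Scoring

namespace Summit.Ventures.LatticeQCDFlow.TrivializingMaps

/-! ## §1 Windows over a geometric floor -/

/-- **A geometric all-lag floor sums to a linear window floor**: if `0 ≤ θ ≤ 1` and `θ^{t+1} ≤ ρ(t+1)` for
every `t < W`, then `½ + W·θ^W ≤ τ_W(ρ)`. [ours] -/
theorem tauIntWindow_ge_of_pow_le {ρ : ℕ → ℝ} {θ : ℝ} (h0 : 0 ≤ θ) (h1 : θ ≤ 1) (W : ℕ)
    (hρ : ∀ t < W, θ ^ (t + 1) ≤ ρ (t + 1)) :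
    1 / 2 + W * θ ^ W ≤ tauIntWindow ρ W := by
  unfold tauIntWindow
  have hsum : ∑ _t ∈ Finset.range W, θ ^ W ≤ ∑ t ∈ Finset.range W, ρ (t + 1) := by
    refine Finset.sum_le_sum fun t ht => le_trans ?_ (hρ t (Finset.mem_range.1 ht))
    exact pow_le_pow_of_le_one h0 h1 (Nat.succ_le_of_lt (Finset.mem_range.1 ht))
  rw [Finset.sum_const, Finset.card_range, nsmul_eq_mul] at hsum
  linarith

/-! ## §2 The exact flow sampler of the Wilson measure -/

section Wilson

variable {d L N : ℕ} [NeZero L] {G : Type*} [Group G] [TopologicalSpace G] [IsTopologicalGroup G]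
  [CompactSpace G] [MeasurableSpace G] [BorelSpace G] [SecondCountableTopology G]
  (ρ : G →* Matrix (Fin N) (Fin N) ℂ)

/-- **WINDOWED `τ_int` FLOOR FOR THE EXACT FLOW SAMPLER OF THE WILSON MEASURE** (every compact `G`, every real
`β`, model density `0 < q` with `∫ q dD[U] = 1`, bounded measurable `g` with `E_{μ_β}[g²] > 0`): for every
window `W`, `τ_W(ρ_g) ≥ ½ + W·(max 0 (1 − B²·acc/E_{μ_β}[g²]))^W`. [ours] -/
theorem wilson_flow_tauIntWindow_ge (hρ : Continuous ρ) (β : ℝ) {q : GaugeConfig d L G → ℝ}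
    (hqm : Measurable q) (hq0 : ∀ U, 0 < q U) (hq1 : ∫ U, q U ∂(trivialMeasure G d L) = 1)
    {g : GaugeConfig d L G → ℝ} (hgm : Measurable g) {B : ℝ} (hgb : ∀ U, |g U| ≤ B)
    (hpos : 0 < ∫ U, g U ^ 2 ∂(wilsonMeasure (d := d) (L := L) ρ β)) (W : ℕ) :
    1 / 2 + W * (max 0 (1 - B ^ 2 *
        (∫ z, min (exp (β * (-wilsonAction ρ z.1)) /
              mgf (fun U => -wilsonAction ρ U) (trivialMeasure G d L) β * q z.2)
            (exp (β * (-wilsonAction ρ z.2)) /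
              mgf (fun U => -wilsonAction ρ U) (trivialMeasure G d L) β * q z.1)
            ∂((trivialMeasure G d L).prod (trivialMeasure G d L))) /
        ∫ U, g U ^ 2 ∂(wilsonMeasure (d := d) (L := L) ρ β))) ^ W ≤
      tauIntWindow (fun n => (∫ U, g U * ((imhOp (trivialMeasure G d L)
          (fun U => exp (β * (-wilsonAction ρ U)) / mgf (fun U => -wilsonAction ρ U) (trivialMeasure G d L) β)
          q)^[n] g) U ∂(wilsonMeasure (d := d) (L := L) ρ β)) /
        ∫ U, g U ^ 2 ∂(wilsonMeasure (d := d) (L := L) ρ β)) W := by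
  refine tauIntWindow_ge_of_pow_le (le_max_left _ _) (max_le zero_le_one ?_) W fun t _ =>
    wilson_flow_autocorr_ge_pow ρ hρ β hqm hq0 hq1 hgm hgb hpos t
  have hA : 0 ≤ ∫ z, min (exp (β * (-wilsonAction ρ z.1)) /
        mgf (fun U => -wilsonAction ρ U) (trivialMeasure G d L) β * q z.2)
      (exp (β * (-wilsonAction ρ z.2)) /
        mgf (fun U => -wilsonAction ρ U) (trivialMeasure G d L) β * q z.1)
      ∂((trivialMeasure G d L).prod (trivialMeasure G d L)) := by
    haveI : IsProbabilityMeasure (trivialMeasure G d L) := trivialMeasure_isProbabilityMeasure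
    have hmgf : 0 ≤ mgf (fun U => -wilsonAction ρ U) (trivialMeasure G d L) β := mgf_nonneg
    exact integral_nonneg fun z => le_min
      (mul_nonneg (div_nonneg (exp_pos _).le hmgf) (hq0 _).le)
      (mul_nonneg (div_nonneg (exp_pos _).le hmgf) (hq0 _).le)
  have : 0 ≤ B ^ 2 * _ / ∫ U, g U ^ 2 ∂(wilsonMeasure (d := d) (L := L) ρ β) :=
    div_nonneg (mul_nonneg (sq_nonneg B) hA) hpos.le
  linarith

/-- **EXPLICITLY AT EVERY COUPLING, EVERY COMPACT GAUGE GROUP** (unitary `ρ`, `d ≥ 2`, `L ≥ 2`, `β ≥ 0`, model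
density `0 < q ≤ C`): for every window `W`,
`τ_W(ρ_g) ≥ ½ + W·(max 0 (1 − B²·C·exp(−e^{−β·2NK(1+4K)}⌊L/2⌋^d·Var_Haar(Re tr ρ)·β²/4)/E_{μ_β}[g²]))^W`,
`K = (d+1)d²`. [ours] -/
theorem wilson_flow_tauIntWindow_ge_allCouplings (hd : 2 ≤ d) (hL : 2 ≤ L) (hρ : Continuous ρ)
    (hρu : ∀ g, ρ g ∈ Matrix.unitaryGroup (Fin N) ℂ) {β : ℝ} (hβ : 0 ≤ β)
    {q : GaugeConfig d L G → ℝ} (hqm : Measurable q) (hq0 : ∀ U, 0 < q U) {C : ℝ} (hqC : ∀ U, q U ≤ C)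
    (hq1 : ∫ U, q U ∂(trivialMeasure G d L) = 1)
    {g : GaugeConfig d L G → ℝ} (hgm : Measurable g) {B : ℝ} (hgb : ∀ U, |g U| ≤ B)
    (hpos : 0 < ∫ U, g U ^ 2 ∂(wilsonMeasure (d := d) (L := L) ρ β)) (W : ℕ) :
    1 / 2 + W * (max 0 (1 - B ^ 2 * (C * exp (-(Real.exp (-(β * (2 * N * ((d + 1) * d ^ 2 : ℕ) *
        (1 + 4 * ((d + 1) * d ^ 2 : ℕ))))) * ((L / 2) ^ d : ℕ) *
        variance (fun g => (ρ g).trace.re) (haarProbability G) * β ^ 2 / 4))) /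
        ∫ U, g U ^ 2 ∂(wilsonMeasure (d := d) (L := L) ρ β))) ^ W ≤
      tauIntWindow (fun n => (∫ U, g U * ((imhOp (trivialMeasure G d L)
          (fun U => exp (β * (-wilsonAction ρ U)) / mgf (fun U => -wilsonAction ρ U) (trivialMeasure G d L) β)
          q)^[n] g) U ∂(wilsonMeasure (d := d) (L := L) ρ β)) /
        ∫ U, g U ^ 2 ∂(wilsonMeasure (d := d) (L := L) ρ β)) W := by
  refine tauIntWindow_ge_of_pow_le (le_max_left _ _) (max_le zero_le_one ?_) W fun t _ =>
    wilson_flow_autocorr_ge_pow_allCouplings ρ hd hL hρ hρu hβ hqm hq0 hqC hq1 hgm hgb hpos t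
  have hC : 0 ≤ C := (hq0 (Classical.arbitrary _)).le.trans (hqC _)
  have : 0 ≤ B ^ 2 * (C * exp (-(Real.exp (-(β * (2 * N * ((d + 1) * d ^ 2 : ℕ) *
        (1 + 4 * ((d + 1) * d ^ 2 : ℕ))))) * ((L / 2) ^ d : ℕ) *
        variance (fun g => (ρ g).trace.re) (haarProbability G) * β ^ 2 / 4))) /
        ∫ U, g U ^ 2 ∂(wilsonMeasure (d := d) (L := L) ρ β) :=
    div_nonneg (mul_nonneg (sq_nonneg B) (mul_nonneg hC (exp_pos _).le)) hpos.le
  linarith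

end Wilson

end Summit.Ventures.LatticeQCDFlow.TrivializingMaps

end
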